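import Mathlib
import Summits.QuantumFields.BalabanUV.Beta.FP.TorusLaplaceComparison
import Summits.QuantumFields.BalabanUV.Beta.FP.TorusSupersolution

/-!
# Road «FP», row IR-5′ (c′) — FILE F4: the BLOCK-WEIGHT VARIANCE BOUND for the free massive resolvent
# `(Δ + 1)⁻¹ = (n²L₁ + 1)⁻¹` on the fine torus: `Re⟨g, (Δ+1)⁻¹g⟩ ≤ (Σg)·(sup g)·(D+2)³R²∕(4n²)`

Cell `pub-balaban`, β sub-cell, binder row D1, road «FP» (owner `b2b-balaban-beta-d1-p3`, «GO» journal
2026-08-21T10:09Z), lane (U2) IR-5′ (unit `b2b-balaban-beta-d1-formalise-leaf-05`, gen 17).  Fourth module of the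
m-UNIFORM SUP LETTER of the perfect ff block (`FF-SUP-PLAN.md`): F2 `FP/TorusLaplaceComparison` (comparison with
a supersolution) + F3b `FP/TorusSupersolution` (the explicit supersolution `ψ_c = 1∕(|x̃ − c̃|² + R²)`) give, for a
non-negative real weight `g` on `Tor (fine n M) × Fin D` supported in the box `{|valMinAbs((x − c)_μ)| ≤ R} × Fin D`:

  **`re_form_LapOne_inv_le_box`**: `Re⟨g, (Δ+1)⁻¹g⟩ ≤ (Σ_i g_i) · gmax · ((D+2)³·R²∕(4·n²))`

whenever `0 ≤ g ≤ gmax`, `4 ≤ D`, `D + 2 ≤ R²`, `4 ≤ R²`, and the fine torus is large: `16·D·n² + 10 ≤ n·M_ν` and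
`2R + 2 < n·M_ν` for every `ν` (the comparison function is `v = (gmax∕(n²c₀))·ψ_c`, `c₀ = 4∕((D+2)³R⁴)`,
`ψ_c ≤ 1∕R²`).  For the road (D = 4, block side `Mb`, `R ≍ Mb`, `Σg = 1`, `gmax ≤ Mb⁻⁴`) the right side is
`≍ Mb⁻²∕n²` — exactly what cancels the ff prefactor `½Mb²n²` of the (j,m)-resolvent (F5).

HONEST SCOPE: [folklore]; elementary; constants explicit and crude; no B5 statement used.  0∕4 row-D1 binders;
NOT hfar, NOT hRb, NOT (ASYMP), NOT D1, NOT BetaPertH, NOT continuum, NOT Clay.  HONEST DEPENDENCY: continuum YM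
on T⁴ ⇐ BetaPertH ∧ nine spine estimates (0/9 proved); BetaPertH ⇐ (D1) ∧ (D4) ∧ CAP+tail; G-an2-4 gates asym,
D1 and NE2/3/4.
-/

noncomputable section

open scoped BigOperators Matrix ComplexConjugate

namespace Summit.QuantumFields.BalabanUV.Beta.FP.BlockMeanVariance

open Matrix
open Literature.MathematicalPhysics.QuantumFieldTheory.Balaban1983to89
open Literature.MathematicalPhysics.QuantumFieldTheory.Balaban1983to89.B5Prop11Plancherel
open Literature.MathematicalPhysics.QuantumFieldTheory.Balaban1983to89.B5Prop11Lower
open Summit.QuantumFields.BalabanUV.Beta.FP.TorusLaplaceComparison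
open Summit.QuantumFields.BalabanUV.Beta.FP.TorusSupersolution

variable {D : ℕ} (n : ℕ) [NeZero n] (M : Fin D → ℕ) [hM : ∀ μ, NeZero (M μ)]

omit [NeZero n] hM in
/-- `ψ_c ≤ 1∕R²`. [folklore] -/
theorem psi_le (R : ℝ) (hR : 0 < R ^ 2) (c x : Tor (fine n M)) :
    1 / (∑ μ, (((x - c) μ).valMinAbs : ℝ) ^ 2 + R ^ 2) ≤ 1 / R ^ 2 := by
  apply one_div_le_one_div_of_le hR
  have := Finset.sum_nonneg fun μ (_ : μ ∈ Finset.univ) => sq_nonneg ((((x - c) μ).valMinAbs : ℝ))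
  linarith

/-- **THE BLOCK-WEIGHT VARIANCE BOUND.** For a real weight `0 ≤ g ≤ gmax` supported in the box of radius `R` about
`c` (in centred representatives), `Re⟨g,(Δ+1)⁻¹g⟩ ≤ (Σg)·gmax·(D+2)³R²∕(4n²)` on every large fine torus. [folklore] -/
theorem re_form_LapOne_inv_le_box (hD : 4 ≤ D) (R : ℝ) (hR : (D : ℝ) + 2 ≤ R ^ 2) (hR4 : 4 ≤ R ^ 2)
    (hPt : ∀ ν, 16 * (D : ℝ) * (n : ℝ) ^ 2 + 10 ≤ ((n * M ν : ℕ) : ℝ))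
    (hPR : ∀ ν, 2 * R + 2 < ((n * M ν : ℕ) : ℝ))
    (c : Tor (fine n M)) (g : Tor (fine n M) × Fin D → ℝ) (gmax : ℝ)
    (hg0 : ∀ i, 0 ≤ g i) (hgmax : ∀ i, g i ≤ gmax)
    (hsupp : ∀ x κ, g (x, κ) ≠ 0 → ∀ μ, |(((x - c) μ).valMinAbs : ℝ)| ≤ R) :
    (star (fun j => (g j : ℂ)) ⬝ᵥ ((Lap n M + 1)⁻¹ *ᵥ fun j => (g j : ℂ))).re
      ≤ (∑ i, g i) * (gmax * (((D : ℝ) + 2) ^ 3 * R ^ 2 / (4 * (n : ℝ) ^ 2))) := by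
  -- the profile and its two properties (F3b)
  set ψ : Tor (fine n M) → ℝ := fun x => 1 / (∑ μ, (((x - c) μ).valMinAbs : ℝ) ^ 2 + R ^ 2) with hψdef
  have hψ : ∀ x, ψ x = 1 / (∑ μ, (((x - c) μ).valMinAbs : ℝ) ^ 2 + R ^ 2) := fun x => rfl
  have hn : (1 : ℝ) ≤ n := by exact_mod_cast Nat.one_le_iff_ne_zero.mpr (NeZero.ne n)
  have ht : (0 : ℝ) ≤ (n : ℝ) ^ 2 := by positivity
  have hR0 : 0 < R ^ 2 := by linarith
  have hRp4 : 0 < R ^ 4 := by rw [show (4 : ℕ) = 2 + 2 from rfl, pow_add]; exact mul_pos hR0 hR0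
  set c₀ : ℝ := 4 / (((D : ℝ) + 2) ^ 3 * R ^ 4) with hc₀
  have hc₀pos : 0 < c₀ := by rw [hc₀]; positivity
  -- gmax ≥ 0 (if the index type is empty the sum is zero anyway; we use a point if there is one)
  by_cases hne : (∑ i, g i) = 0
  · -- then g = 0 and the form vanishes
    have hgz : ∀ i, g i = 0 := fun i =>
      (Finset.sum_eq_zero_iff_of_nonneg (fun j _ => hg0 j)).mp hne i (Finset.mem_univ i)
    have : (fun j => (g j : ℂ)) = 0 := funext fun j => by rw [hgz j]; simp
    rw [this, hne]
    simp
  have hgmax0 : 0 ≤ gmax := by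
    obtain ⟨i, -, hi⟩ := Finset.exists_ne_zero_of_sum_ne_zero hne
    exact (hg0 i).trans (hgmax i)
  -- the comparison function
  set K : ℝ := gmax / ((n : ℝ) ^ 2 * c₀) with hK
  have hK0 : 0 ≤ K := by rw [hK]; positivity
  set v : Tor (fine n M) × Fin D → ℝ := fun i => K * ψ i.1 with hv
  -- supersolution property
  have hsuper : ∀ x κ, g (x, κ) ≤ (n : ℝ) ^ 2 * ∑ ν, (2 * v (x, κ) - v (x + unitVec (fine n M) ν, κ)
      - v (x - unitVec (fine n M) ν, κ)) + v (x, κ) := by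
    intro x κ
    have e1 : ∑ ν, (2 * v (x, κ) - v (x + unitVec (fine n M) ν, κ) - v (x - unitVec (fine n M) ν, κ))
        = K * ∑ ν, (2 * ψ x - ψ (x + unitVec (fine n M) ν) - ψ (x - unitVec (fine n M) ν)) := by
      rw [Finset.mul_sum]
      exact Finset.sum_congr rfl fun ν _ => by simp only [hv]; ring
    have e : (n : ℝ) ^ 2 * ∑ ν, (2 * v (x, κ) - v (x + unitVec (fine n M) ν, κ) - v (x - unitVec (fine n M) ν, κ))
        + v (x, κ)
        = K * ((n : ℝ) ^ 2 * ∑ ν, (2 * ψ x - ψ (x + unitVec (fine n M) ν) - ψ (x - unitVec (fine n M) ν)) + ψ x) := by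
      rw [e1]
      simp only [hv]
      ring
    rw [e]
    by_cases hgx : g (x, κ) = 0
    · rw [hgx]
      exact mul_nonneg hK0 (supersolution_nonneg_centre (fine n M) R ((n : ℝ) ^ 2) c ψ hψ hD hR hR4 ht hPt x)
    · have hbox := hsupp x κ hgx
      have hb := supersolution_box_centre (fine n M) R ((n : ℝ) ^ 2) c ψ hψ hD hR hR4 ht hPR x hbox
      have hKc : K * ((n : ℝ) ^ 2 * c₀) = gmax := by
        rw [hK]; field_simp
      calc g (x, κ) ≤ gmax := hgmax _
        _ = K * ((n : ℝ) ^ 2 * (4 / (((D : ℝ) + 2) ^ 3 * R ^ 4))) := by rw [← hc₀, hKc]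
        _ ≤ _ := mul_le_mul_of_nonneg_left hb hK0
  -- the sup of v
  have hvB : ∀ i, g i ≠ 0 → v i ≤ K * (1 / R ^ 2) := fun i _ =>
    mul_le_mul_of_nonneg_left (psi_le n M R hR0 c i.1) hK0
  have h := re_form_LapOne_inv_le_sup n M g v hg0 hsuper hvB
  refine h.trans (le_of_eq ?_)
  rw [hK, hc₀]
  field_simp

end Summit.QuantumFields.BalabanUV.Beta.FP.BlockMeanVariance
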